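import Summits.BirchSwinnertonDyer.Rank1Residual.Additive.X3CertificateDisplayKit
import Literature.NumberTheory.EllipticCurves.GreenbergVatsal2000.CharacterLValueCEulerFactorProofs
import Literature.NumberTheory.EllipticCurves.GreenbergVatsal2000.CharacterLambdaCertificateProofs
import Literature.NumberTheory.LFunctions.Hinkkanen1997.BernoulliTable
import HarnessLib

/-!
# X3 certificate road at `p = 3` — display kit II: the two `λ`-CERTIFICATES of a pair from RATIONAL
# VALUE TABLES in ONE step (any order `a ≤ 15`), with the `C`-side values in Greenberg–Vatsal's
# EULER-FACTOR form (period `3q`, not `3q∏ℓ`) (cell `bsd-eis`, seat `bsd-eis-x3` gen 5; THEOREMS ONLY)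

HONEST FRAMING (FULL-BSD rank-`≤ 1` programme D-0033, cell `bsd-eis`, `run/shared/lean/pub/bsd-eis/README.md`
§4): plumbing shared by the generated per-pair displays `X3CertificateDisplay<label>.lean` of the x3
certificate road (x3-MEMO-6). Nothing here is specific to a curve and nothing is booked. Compared with the
gen-4 kit: (i) the `C`-side interpolation values `characterLValueC 3 φ Σ₀ k` are read through
`characterLValueC_three_eq_ratCast_eulerFactor` (GV p. 42: `Σ₀`-depletion = multiplication by the Euler
factors `1 − χ_k(ℓ)ℓ^{k−1}`; Literature `CharacterLValueCEulerFactorProofs.lean`), so a display sums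
`3q` terms instead of `3q·∏_{ℓ∈Σ₀} ℓ` (the gen-4 displays with `∏ℓ` large timed out in the gate);
(ii) the Bernoulli polynomials `B_k`, `k ≤ 16`, are evaluated through an explicit table of Bernoulli
numbers, so no per-degree `bernoulli_k_eval` lemma is needed; (iii) the divided-difference certificate
(`order_toNat_eq_of_isCharacterLFunctionC/D_of_lagrange`, Greenberg 2001 p. 356) is packaged ONCE for
every order `a`: given a rational value table `V` with `characterLValueC/D 3 θ Σ₀ (i+1) = V i` (`i ≤ a`),
`ord_T(g mod 3) = a` follows from DECIDABLE statements about the rational Lagrange sums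
`∑_{i≤j} V_i/∏_{l≤j, l≠i}(4^{±i} − 4^{±l})` (`κ(γ) = 4`): `= 0` or of positive `3`-adic valuation for
`j < a`, nonzero of valuation `≤ 0` for `j = a`.

* `bernoulli_eq_table`, `bernoulli_eval_eq_table` (`k ≤ 16`; the values `B'_6 … B'_16` are the tree's
  `PeriodPair.bernoulli'_six` and `Hinkkanen1997.bernoulli'_n`);
* `characterLValueC_three_eq_ratCast_table` / `characterLValueD_three_eq_ratCast_table` — value tables
  over an explicit `Σ₀` (hypothesis `hS : ∀ f, ∏_{v∈Σ₀} f(ℓ_v) = PF f`, supplied per pair);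
* `orderC_three_eq_of_ratValues` / `orderD_three_eq_of_ratValues` — the certificates.

References: [GreenbergVatsal2000] §3 pp. 41–42 ((26), (27), the Σ₀-Euler factors); [Greenberg2001PastPresent]
§4 p. 356; [LangCyclotomic1990] Ch. 2 §2 (B 7), Ch. 4 §3 Thm. 3.2.
-/

set_option autoImplicit false

noncomputable section

open scoped Classical

open Finset NumberField IsDedekindDomain Polynomial Literature.NumberTheory.LFunctions
  Literature.NumberTheory.EllipticCurves
  Literature.NumberTheory.EllipticCurves.GreenbergVatsal2000

namespace Summit.BirchSwinnertonDyer.Rank1Residual.Additive.X3CertificateDisplayKit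

/-! ## §1 Bernoulli numbers `B_0, …, B_16` and the Bernoulli polynomials `B_k(x)`, `k ≤ 16`, as a table -/

/-- **The Bernoulli numbers `B_i` (Mathlib's `bernoulli`, `B₁ = −1/2`), `i ≤ 16`, as an explicit table.**
[folklore] -/
theorem bernoulli_eq_table (i : ℕ) (hi : i ≤ 16) :
    _root_.bernoulli i =
      (fun i : ℕ ↦ (if i = 0 then 1 else if i = 1 then -1 / 2 else if i = 2 then 1 / 6 else if i = 4 then -1 / 30
        else if i = 6 then 1 / 42 else if i = 8 then -1 / 30 else if i = 10 then 5 / 66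
        else if i = 12 then -691 / 2730 else if i = 14 then 7 / 6 else if i = 16 then -3617 / 510 else 0 : ℚ)) i := by
  interval_cases i
  · simp [_root_.bernoulli_zero]
  · simp [_root_.bernoulli_one]
  · rw [bernoulli_eq_bernoulli'_of_ne_one (by decide : (2 : ℕ) ≠ 1), bernoulli'_two]; simp
  · rw [bernoulli_eq_bernoulli'_of_ne_one (by decide : (3 : ℕ) ≠ 1), bernoulli'_three]; simp
  · rw [bernoulli_eq_bernoulli'_of_ne_one (by decide : (4 : ℕ) ≠ 1), bernoulli'_four]; simp
  · rw [bernoulli_eq_bernoulli'_of_ne_one (by decide : (5 : ℕ) ≠ 1),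
      bernoulli'_eq_zero_of_odd (by decide : Odd 5) (by decide : 1 < 5)]; simp
  · rw [bernoulli_eq_bernoulli'_of_ne_one (by decide : (6 : ℕ) ≠ 1), PeriodPair.bernoulli'_six]; simp
  · rw [bernoulli_eq_bernoulli'_of_ne_one (by decide : (7 : ℕ) ≠ 1), Hinkkanen1997.bernoulli'_7]; simp
  · rw [bernoulli_eq_bernoulli'_of_ne_one (by decide : (8 : ℕ) ≠ 1), Hinkkanen1997.bernoulli'_8]; simp
  · rw [bernoulli_eq_bernoulli'_of_ne_one (by decide : (9 : ℕ) ≠ 1), Hinkkanen1997.bernoulli'_9]; simp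
  · rw [bernoulli_eq_bernoulli'_of_ne_one (by decide : (10 : ℕ) ≠ 1), Hinkkanen1997.bernoulli'_10]; simp
  · rw [bernoulli_eq_bernoulli'_of_ne_one (by decide : (11 : ℕ) ≠ 1), Hinkkanen1997.bernoulli'_11]; simp
  · rw [bernoulli_eq_bernoulli'_of_ne_one (by decide : (12 : ℕ) ≠ 1), Hinkkanen1997.bernoulli'_12]; simp
  · rw [bernoulli_eq_bernoulli'_of_ne_one (by decide : (13 : ℕ) ≠ 1), Hinkkanen1997.bernoulli'_13]; simp
  · rw [bernoulli_eq_bernoulli'_of_ne_one (by decide : (14 : ℕ) ≠ 1), Hinkkanen1997.bernoulli'_14]; simp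
  · rw [bernoulli_eq_bernoulli'_of_ne_one (by decide : (15 : ℕ) ≠ 1), Hinkkanen1997.bernoulli'_15]; simp
  · rw [bernoulli_eq_bernoulli'_of_ne_one (by decide : (16 : ℕ) ≠ 1), Hinkkanen1997.bernoulli'_16]; simp

/-- **`B_k(x) = ∑_{i≤k} B_i·C(k,i)·x^{k−i}`, `k ≤ 16`, with the tabulated `B_i`** (Mathlib's definition of
`Polynomial.bernoulli` evaluated at a rational `x`; the form a display evaluates by `decide`). [folklore] -/
theorem bernoulli_eval_eq_table (k : ℕ) (hk : k ≤ 16) (x : ℚ) :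
    (Polynomial.bernoulli k).eval x =
      ∑ i ∈ Finset.range (k + 1),
        (fun i : ℕ ↦ (if i = 0 then 1 else if i = 1 then -1 / 2 else if i = 2 then 1 / 6 else if i = 4 then -1 / 30
          else if i = 6 then 1 / 42 else if i = 8 then -1 / 30 else if i = 10 then 5 / 66
          else if i = 12 then -691 / 2730 else if i = 14 then 7 / 6 else if i = 16 then -3617 / 510 else 0 : ℚ)) i *
          (k.choose i : ℚ) * x ^ (k - i) := by
  rw [Polynomial.bernoulli, Polynomial.eval_finsetSum]
  refine Finset.sum_congr rfl fun i hi ↦ ?_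
  have hi' : i ≤ 16 := by have := Finset.mem_range.mp hi; omega
  rw [Polynomial.eval_monomial, bernoulli_eq_table i hi']

/-! ## §2 The `C`-side: value table in Euler-factor form, and the certificate -/

section CSide

variable {m : ℕ} (φ : DirichletCharacter (ZMod 3) m) (S₀ : Finset (HeightOneSpectrum (𝓞 ℚ)))

/-- **`C`-side VALUE TABLE** (`k ≥ 1`, `k ≤ 16`, `m ≥ 1`): `characterLValueC 3 φ Σ₀ k` is the cast of
`PF(ℓ ↦ 1 − t_k(ℓ)ℓ^{k−1}) · (−(1/k)·(3m)^{k−1}·∑_{a<3m} t_k(a)·B_k(a/(3m)))`, where `t_k(a) ∈ {0, ±1}` is the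
integer lift of `φ(a)(a⁻¹)^k ∈ 𝔽₃` (`0` if `3 ∣ a`), `B_k` is tabulated, and `PF` is the product over the
explicit `Σ₀` of the pair (`hS`). GV (26) + p. 42 (Euler factors) + Lang Thm. 3.2, in decidable form.
[cite: GreenbergVatsal2000, §3 pp. 41–42 ((26) and the Σ₀-Euler factors)] [cite: LangCyclotomic1990, Ch. 2 §2 (B 7), Ch. 4 §3 Thm. 3.2] -/
theorem characterLValueC_three_eq_ratCast_table (PF : (ℕ → ℚ) → ℚ)
    (hS : ∀ f : ℕ → ℚ, ∏ v ∈ S₀, f (Rat.HeightOneSpectrum.natGenerator v) = PF f)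
    (hm : 0 < m) {k : ℕ} (hk : 1 ≤ k) (hk' : k ≤ 16) :
    characterLValueC 3 φ S₀ k =
      ((PF (fun ℓ ↦ 1 - ((if 3 ∣ ℓ then 0 else
              (if φ (ℓ : ZMod m) * ((ℓ : ZMod 3)⁻¹) ^ k = 0 then 0
                else if φ (ℓ : ZMod m) * ((ℓ : ZMod 3)⁻¹) ^ k = 1 then 1 else -1) : ℤ) : ℚ) *
            (ℓ : ℚ) ^ (k - 1)) *
        (-(1 / (k : ℚ)) * (((m * 3 : ℕ) : ℚ) ^ (k - 1) *
          ∑ a ∈ Finset.range (m * 3),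
            ((if 3 ∣ a then 0 else
              (if φ (a : ZMod m) * ((a : ZMod 3)⁻¹) ^ k = 0 then 0
                else if φ (a : ZMod m) * ((a : ZMod 3)⁻¹) ^ k = 1 then 1 else -1) : ℤ) : ℚ) *
              ∑ i ∈ Finset.range (k + 1),
                (fun i : ℕ ↦ (if i = 0 then 1 else if i = 1 then -1 / 2 else if i = 2 then 1 / 6
                  else if i = 4 then -1 / 30 else if i = 6 then 1 / 42 else if i = 8 then -1 / 30
                  else if i = 10 then 5 / 66 else if i = 12 then -691 / 2730 else if i = 14 then 7 / 6
                  else if i = 16 then -3617 / 510 else 0 : ℚ)) i * (k.choose i : ℚ) *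
                  ((a : ℚ) / ((m * 3 : ℕ) : ℚ)) ^ (k - i))) : ℚ) : ℚ_[3]) := by
  rw [characterLValueC_three_eq_ratCast_eulerFactor φ S₀ hk hm]
  have h1 := hS (fun ℓ ↦ 1 - ((if 3 ∣ ℓ then 0 else
      (if φ (ℓ : ZMod m) * ((ℓ : ZMod 3)⁻¹) ^ k = 0 then 0
        else if φ (ℓ : ZMod m) * ((ℓ : ZMod 3)⁻¹) ^ k = 1 then 1 else -1) : ℤ) : ℚ) * (ℓ : ℚ) ^ (k - 1))
  rw [h1, Finset.sum_congr rfl (fun a _ ↦ by rw [bernoulli_eval_eq_table k hk'])]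

/-- Casting a rational Lagrange sum at the nodes `4^i − 1` into `ℚ₃`. [folklore] -/
private theorem lagrangeC_cast (V : ℕ → ℚ) (n : ℕ) (W : ℕ → ℚ_[3]) (hW : ∀ i ≤ n, W i = ((V i : ℚ) : ℚ_[3])) :
    ∑ i ∈ range (n + 1), W i / ∏ l ∈ (range (n + 1)).erase i,
        (((((4 : ℕ) : ℕ) : ℚ_[3]) ^ i - 1) - ((((4 : ℕ) : ℕ) : ℚ_[3]) ^ l - 1)) =
      ((∑ i ∈ range (n + 1), V i / ∏ l ∈ (range (n + 1)).erase i, ((4 : ℚ) ^ i - 4 ^ l) : ℚ) : ℚ_[3]) := by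
  push_cast
  refine Finset.sum_congr rfl fun i hi ↦ ?_
  rw [hW i (by have := Finset.mem_range.mp hi; omega)]
  congr 1
  refine Finset.prod_congr rfl fun l _ ↦ ?_
  ring

/-- **`C`-side `λ`-CERTIFICATE from a rational value table** (`κ(γ) = 4`): if
`characterLValueC 3 φ Σ₀ (i+1) = V i` for `i ≤ a`, the Lagrange sums `L_j = ∑_{i≤j} V_i/∏_{l≤j,l≠i}(4^i − 4^l)`
vanish or have positive `3`-adic valuation for `j < a`, and `L_a ≠ 0` has valuation `≤ 0`, then
`ord_T(L_{Σ₀}(C ⊗ χ, T) mod 3) = a` (divided differences, Greenberg 2001 p. 356; GV (26)).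
[cite: GreenbergVatsal2000, §3 p. 41 (26)] [cite: Greenberg2001PastPresent, §4 p. 356] -/
theorem orderC_three_eq_of_ratValues {g : IwasawaAlgebra 3} (hg : IsCharacterLFunctionC 3 φ S₀ g) {a : ℕ}
    (V : ℕ → ℚ) (hV : ∀ i ≤ a, characterLValueC 3 φ S₀ (i + 1) = ((V i : ℚ) : ℚ_[3]))
    (hlt : ∀ j < a, (∑ i ∈ range (j + 1), V i / ∏ l ∈ (range (j + 1)).erase i, ((4 : ℚ) ^ i - 4 ^ l)) = 0 ∨
      0 < padicValRat 3 (∑ i ∈ range (j + 1), V i / ∏ l ∈ (range (j + 1)).erase i, ((4 : ℚ) ^ i - 4 ^ l)))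
    (hge : (∑ i ∈ range (a + 1), V i / ∏ l ∈ (range (a + 1)).erase i, ((4 : ℚ) ^ i - 4 ^ l)) ≠ 0 ∧
      padicValRat 3 (∑ i ∈ range (a + 1), V i / ∏ l ∈ (range (a + 1)).erase i, ((4 : ℚ) ^ i - 4 ^ l)) ≤ 0) :
    (PowerSeries.map (PadicInt.toZMod (p := 3)) g).order.toNat = a := by
  refine order_toNat_eq_of_isCharacterLFunctionC_of_lagrange 3 φ S₀ hg (a := a) ?_ ?_
  · intro j hj
    rw [cyclotomicGenerator_three,
      lagrangeC_cast V j (fun i ↦ characterLValueC 3 φ S₀ (i + 1)) (fun i hi ↦ hV i (by omega))]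
    exact norm_ratCast_lt_one_of_padicValRat_pos 3 (hlt j hj)
  · rw [cyclotomicGenerator_three,
      lagrangeC_cast V a (fun i ↦ characterLValueC 3 φ S₀ (i + 1)) (fun i hi ↦ hV i hi)]
    exact one_le_norm_ratCast_of_padicValRat_nonpos 3 hge.1 hge.2

end CSide

/-! ## §3 The `D`-side: value table, and the certificate -/

section DSide

variable {d : ℕ} (ψ : DirichletCharacter (ZMod 3) d) (S₀ : Finset (HeightOneSpectrum (𝓞 ℚ)))

/-- **`D`-side VALUE TABLE** (`k ≤ 16`): `characterLValueD 3 ψ Σ₀ k` is the cast of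
`2·(−(1/k))·(3d)^{k−1}·∑_{a<3d} u_k(a)·B_k(a/(3d)) · PF(ℓ ↦ 1 − e_k(ℓ)·ℓ^{−k})` for a value table `G` of `ψ`
(`hG`), with `B_k` tabulated and `PF` the product over the explicit `Σ₀` (`hS`). GV (27) + p. 42 + Lang
Thm. 3.2, in decidable form. [cite: GreenbergVatsal2000, §3 p. 42 ((27) and the Σ₀-Euler factors)]
[cite: LangCyclotomic1990, Ch. 2 §2 (B 7), Ch. 4 §3 Thm. 3.2] -/
theorem characterLValueD_three_eq_ratCast_table (PF : (ℕ → ℚ) → ℚ)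
    (hS : ∀ f : ℕ → ℚ, ∏ v ∈ S₀, f (Rat.HeightOneSpectrum.natGenerator v) = PF f)
    (G : ℕ → ZMod 3) (hG : ∀ a : ℕ, ψ (a : ZMod d) = G a) {k : ℕ} (hk' : k ≤ 16) :
    characterLValueD 3 ψ S₀ k =
      (((2 * (-(1 / (k : ℚ)) * (((d * 3 : ℕ) : ℚ) ^ (k - 1) *
          ∑ a ∈ Finset.range (d * 3),
            ((if 3 ∣ a then 0 else
              (if ((a : ZMod 3)⁻¹) ^ (k - 1) * (G a)⁻¹ = 0 then 0
                else if ((a : ZMod 3)⁻¹) ^ (k - 1) * (G a)⁻¹ = 1 then 1 else -1) : ℤ) : ℚ) *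
              ∑ i ∈ Finset.range (k + 1),
                (fun i : ℕ ↦ (if i = 0 then 1 else if i = 1 then -1 / 2 else if i = 2 then 1 / 6
                  else if i = 4 then -1 / 30 else if i = 6 then 1 / 42 else if i = 8 then -1 / 30
                  else if i = 10 then 5 / 66 else if i = 12 then -691 / 2730 else if i = 14 then 7 / 6
                  else if i = 16 then -3617 / 510 else 0 : ℚ)) i * (k.choose i : ℚ) *
                  ((a : ℚ) / ((d * 3 : ℕ) : ℚ)) ^ (k - i)))) *
        PF (fun ℓ ↦ 1 - ((if G ℓ * (ℓ : ZMod 3) ^ (k - 1) = 0 then 0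
            else if G ℓ * (ℓ : ZMod 3) ^ (k - 1) = 1 then 1 else -1 : ℤ) : ℚ) * ((ℓ : ℚ)⁻¹) ^ k) : ℚ) :
        ℚ_[3]) := by
  rw [characterLValueD_three_eq_ratCast ψ S₀ k G hG]
  have h1 := hS (fun ℓ ↦ 1 - ((if G ℓ * (ℓ : ZMod 3) ^ (k - 1) = 0 then 0
      else if G ℓ * (ℓ : ZMod 3) ^ (k - 1) = 1 then 1 else -1 : ℤ) : ℚ) * ((ℓ : ℚ)⁻¹) ^ k)
  rw [h1, Finset.sum_congr rfl (fun a _ ↦ by rw [bernoulli_eval_eq_table k hk'])]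

/-- Casting a rational Lagrange sum at the nodes `4^{−i} − 1` into `ℚ₃`. [folklore] -/
private theorem lagrangeD_cast (V : ℕ → ℚ) (n : ℕ) (W : ℕ → ℚ_[3]) (hW : ∀ i ≤ n, W i = ((V i : ℚ) : ℚ_[3])) :
    ∑ i ∈ range (n + 1), W i / ∏ l ∈ (range (n + 1)).erase i,
        ((((((4 : ℕ) : ℕ) : ℚ_[3])⁻¹) ^ i - 1) - (((((4 : ℕ) : ℕ) : ℚ_[3])⁻¹) ^ l - 1)) =
      ((∑ i ∈ range (n + 1), V i / ∏ l ∈ (range (n + 1)).erase i, (((4 : ℚ)⁻¹) ^ i - ((4 : ℚ)⁻¹) ^ l) : ℚ) :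
        ℚ_[3]) := by
  push_cast
  refine Finset.sum_congr rfl fun i hi ↦ ?_
  rw [hW i (by have := Finset.mem_range.mp hi; omega)]
  congr 1
  refine Finset.prod_congr rfl fun l _ ↦ ?_
  ring

/-- **`D`-side `λ`-CERTIFICATE from a rational value table** (nodes `4^{−i} − 1`): if
`characterLValueD 3 ψ Σ₀ (i+1) = V i` for `i ≤ b`, the Lagrange sums `∑_{i≤j} V_i/∏_{l≤j,l≠i}(4^{−i} − 4^{−l})`
vanish or have positive `3`-adic valuation for `j < b`, and the `b`-th is nonzero of valuation `≤ 0`, then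
`ord_T(L_{Σ₀}(D ⊗ χ, T) mod 3) = b` (GV (27); Greenberg 2001 p. 356).
[cite: GreenbergVatsal2000, §3 p. 42 (27)] [cite: Greenberg2001PastPresent, §4 p. 356] -/
theorem orderD_three_eq_of_ratValues {g : IwasawaAlgebra 3} (hg : IsCharacterLFunctionD 3 ψ S₀ g) {b : ℕ}
    (V : ℕ → ℚ) (hV : ∀ i ≤ b, characterLValueD 3 ψ S₀ (i + 1) = ((V i : ℚ) : ℚ_[3]))
    (hlt : ∀ j < b, (∑ i ∈ range (j + 1), V i / ∏ l ∈ (range (j + 1)).erase i,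
        (((4 : ℚ)⁻¹) ^ i - ((4 : ℚ)⁻¹) ^ l)) = 0 ∨
      0 < padicValRat 3 (∑ i ∈ range (j + 1), V i / ∏ l ∈ (range (j + 1)).erase i,
        (((4 : ℚ)⁻¹) ^ i - ((4 : ℚ)⁻¹) ^ l)))
    (hge : (∑ i ∈ range (b + 1), V i / ∏ l ∈ (range (b + 1)).erase i,
        (((4 : ℚ)⁻¹) ^ i - ((4 : ℚ)⁻¹) ^ l)) ≠ 0 ∧
      padicValRat 3 (∑ i ∈ range (b + 1), V i / ∏ l ∈ (range (b + 1)).erase i,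
        (((4 : ℚ)⁻¹) ^ i - ((4 : ℚ)⁻¹) ^ l)) ≤ 0) :
    (PowerSeries.map (PadicInt.toZMod (p := 3)) g).order.toNat = b := by
  refine order_toNat_eq_of_isCharacterLFunctionD_of_lagrange 3 ψ S₀ hg (a := b) ?_ ?_
  · intro j hj
    rw [cyclotomicGenerator_three,
      lagrangeD_cast V j (fun i ↦ characterLValueD 3 ψ S₀ (i + 1)) (fun i hi ↦ hV i (by omega))]
    exact norm_ratCast_lt_one_of_padicValRat_pos 3 (hlt j hj)
  · rw [cyclotomicGenerator_three,
      lagrangeD_cast V b (fun i ↦ characterLValueD 3 ψ S₀ (i + 1)) (fun i hi ↦ hV i hi)]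
    exact one_le_norm_ratCast_of_padicValRat_nonpos 3 hge.1 hge.2

end DSide

end Summit.BirchSwinnertonDyer.Rank1Residual.Additive.X3CertificateDisplayKit

end
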